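import Mathlib.RingTheory.TensorProduct.MvPolynomial
import Mathlib.RingTheory.TensorProduct.Quotient
import Mathlib.RingTheory.TensorProduct.IsBaseChangePi
import Mathlib.RingTheory.TensorProduct.IsBaseChangeRightExact
import Mathlib.RingTheory.FiniteType
import Mathlib.RingTheory.Adjoin.FG
import Mathlib.RingTheory.Polynomial.Basic
import Mathlib.RingTheory.Ideal.Quotient.Operations
import Mathlib.RingTheory.Ideal.Quotient.Noetherian
import HarnessLib

/-!
# Absolute Noetherian approximation of a finitely presented algebra (Stacks 00R0, 00QV)

Let `A` be a ring and `f₁, …, f_m ∈ A[x₁, …, x_n]`. The finitely generated `ℤ`-subalgebras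
`T ⊆ A` containing all coefficients of the `fᵢ` form a directed family with union `A`; for each
such `T` the polynomials `fᵢ` come from unique `fᵢ,T ∈ T[x₁, …, x_n]`, and
`P_T = T[x]/(f_T)` is a finite type algebra over the Noetherian ring `T`, with
`A[x]/(f) = A ⊗_T P_T` and `P_{T′} = T′ ⊗_T P_T`. This is the directed system of The Stacks
Project, Tag 00R0 (Algebra, Lemma 10.127.17: for `R → S` of finite presentation there is a
directed system `R_λ → S_λ` with colimit `R → S`, each `R_λ` of finite type over `ℤ`, each `S_λ` of
finite type over `R_λ`, and `S_λ ⊗_{R_λ} R_μ → S_μ` an isomorphism for `λ ≤ μ`), built as in the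
proof of Tag 00QV (Lemma 10.127.11: the `f_{j, λ} ∈ R_λ[x₁, …, x_n]` and
`S_λ = R_λ[x₁, …, x_n]/(f_{1,λ}, …, f_{m,λ})`), with the `R_λ` taken to be the finitely
generated `ℤ`-subalgebras of `R` containing the coefficients. It is the book-keeping behind every
"limit" argument reducing statements about finitely presented algebras over arbitrary rings to
Noetherian rings (Tags 00R6, 02JO). This file PROVIDES the system and PROVES its colimit
properties at the level of rings:

* `Idx f` — the index type (finitely generated `ℤ`-subalgebras containing the coefficients),
  directed and nonempty; `Idx.adjoin` (enlarge by finitely many elements); each `Idx.T` is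
  Noetherian (`Idx.isNoetherianRing`).
* `Idx.res` — the restricted polynomials `fᵢ,T`, `Idx.map_res`; `Idx.P` — the algebras
  `P_T = T[x]/(f_T)` (Noetherian); `Pinf f = A[x]/(f)`; the maps `Idx.toPinf : P_T → A[x]/(f)`
  and `Idx.incl : P_T → P_{T′}` (`T ≤ T′`) and their compatibilities; the general base change
  `isBaseChange_quotMap` (`B ⊗_T T[x]/(g) = B[x]/(g)`), whence `Idx.isPushout_Pinf`
  (`A[x]/(f) = A ⊗_T P_T`) and `Idx.isPushout_incl` (`P_{T′} = T′ ⊗_T P_T`).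
* colimit properties: `Idx.exists_toPinf_eq` (every element of `A[x]/(f)` comes from some `P_{T′}`
  with `T′ ≥ T`), `Idx.exists_incl_eq_zero` (an element of `P_T` vanishing in `A[x]/(f)`
  vanishes in some `P_{T′}`), `Idx.exists_mem` (every element of `A` lies in some `T′ ≥ T`).

Tree search: the base-ring half of this construction exists at scheme level in
`Literature/AlgebraicGeometry/Limits/SubalgebraDiagram.lean` (`SubalgApprox`: a ring as the
colimit of its finitely generated subalgebras); the `P_T`/pushout content here is new.

## References

* The Stacks Project, Tag 00R0 (Algebra, Lemma 10.127.17) and the proof of Tag 00QV (Algebra,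
  Lemma 10.127.11); Section 10.127 "Colimits and maps of finite presentation". [StacksProject]
-/

universe u

open MvPolynomial

noncomputable section

namespace Literature.RingTheory.Flat

variable {A : Type u} [CommRing A] {n m : ℕ} (f : Fin m → MvPolynomial (Fin n) A)

/-! ### Base change of a quotient of a polynomial ring -/

section QuotBaseChange

variable {T B : Type*} [CommRing T] [CommRing B] [Algebra T B] {k l : ℕ}
  (g : Fin l → MvPolynomial (Fin k) T) (J' : Ideal (MvPolynomial (Fin k) B))
  (hJ' : J' = Ideal.span (Set.range fun i => MvPolynomial.map (algebraMap T B) (g i)))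

attribute [local instance] MvPolynomial.algebraMvPolynomial

/-- The `T`-algebra map `T[x]/(g) → B[x]/J′` induced by `T → B`, for `J′ = (g)B[x]`.
[folklore] -/
def quotMap : (MvPolynomial (Fin k) T ⧸ Ideal.span (Set.range g)) →ₐ[T]
    (MvPolynomial (Fin k) B ⧸ J') :=
  Ideal.Quotient.liftₐ (Ideal.span (Set.range g))
    (((Ideal.Quotient.mkₐ T J').restrictScalars T).comp
      (MvPolynomial.mapAlgHom (Algebra.ofId T B))) (by
    intro p hp
    refine Submodule.span_induction (p := fun p _ =>
      ((Ideal.Quotient.mkₐ T J').restrictScalars T).comp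
        (MvPolynomial.mapAlgHom (Algebra.ofId T B)) p = 0) ?_ ?_ ?_ ?_ hp
    · rintro _ ⟨i, rfl⟩
      change Ideal.Quotient.mk J' (MvPolynomial.map (algebraMap T B) (g i)) = 0
      rw [Ideal.Quotient.eq_zero_iff_mem, hJ']
      exact Ideal.subset_span ⟨i, rfl⟩
    · exact map_zero _
    · intro x y _ _ hx hy
      rw [map_add, hx, hy, add_zero]
    · intro a x _ hx
      rw [smul_eq_mul, map_mul, hx, mul_zero])

/-- `quotMap` on classes of polynomials. [folklore] -/
@[simp] theorem quotMap_mk (p : MvPolynomial (Fin k) T) :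
    quotMap g J' hJ' (Ideal.Quotient.mk _ p) =
      Ideal.Quotient.mk J' (MvPolynomial.map (algebraMap T B) p) := rfl

/-- **`B ⊗_T T[x]/(g) = B[x]/(g)`**: the map `T[x]/(g) → B[x]/(g)B[x]` is a base change (the
content of The Stacks Project, Tag 00R0 (4), "`S_λ ⊗_{R_λ} R_μ → S_μ` is an isomorphism", for
the system of the proof of Tag 00QV; here from Mathlib's `MvPolynomial` pushout and base change
of the right exact sequences `T[x]^l → T[x] → T[x]/(g) → 0`). [cite: StacksProject, Tag 00R0 (4)] -/
theorem isBaseChange_quotMap : IsBaseChange B (quotMap g J' hJ').toLinearMap := by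
  classical
  let PT := MvPolynomial (Fin k) T
  let PB := MvPolynomial (Fin k) B
  let gB : Fin l → PB := fun i => MvPolynomial.map (algebraMap T B) (g i)
  -- the presentations
  let φT : (Fin l → PT) →ₗ[T] PT := (Fintype.linearCombination PT g).restrictScalars T
  let φB : (Fin l → PB) →ₗ[B] PB := (Fintype.linearCombination PB gB).restrictScalars B
  let πT : PT →ₗ[T] PT ⧸ Ideal.span (Set.range g) :=
    (Ideal.Quotient.mkₐ T (Ideal.span (Set.range g))).toLinearMap
  let πB : PB →ₗ[B] PB ⧸ J' := (Ideal.Quotient.mkₐ B J').toLinearMap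
  have hexT : Function.Exact φT πT := by
    intro p
    change Ideal.Quotient.mk (Ideal.span (Set.range g)) p = 0 ↔ p ∈ Set.range φT
    rw [Ideal.Quotient.eq_zero_iff_mem, Ideal.mem_span_range_iff_exists_fun]
    constructor
    · rintro ⟨c, hc⟩
      refine ⟨c, ?_⟩
      change Fintype.linearCombination PT g c = p
      rw [Fintype.linearCombination_apply]
      simpa only [smul_eq_mul] using hc
    · rintro ⟨c, rfl⟩
      refine ⟨c, ?_⟩
      change _ = Fintype.linearCombination PT g c
      rw [Fintype.linearCombination_apply]
      simp only [smul_eq_mul]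
  have hexB : Function.Exact φB πB := by
    intro p
    change Ideal.Quotient.mk J' p = 0 ↔ p ∈ Set.range φB
    rw [Ideal.Quotient.eq_zero_iff_mem, hJ', Ideal.mem_span_range_iff_exists_fun]
    constructor
    · rintro ⟨c, hc⟩
      refine ⟨c, ?_⟩
      change Fintype.linearCombination PB gB c = p
      rw [Fintype.linearCombination_apply]
      simpa only [smul_eq_mul] using hc
    · rintro ⟨c, rfl⟩
      refine ⟨c, ?_⟩
      change _ = Fintype.linearCombination PB gB c
      rw [Fintype.linearCombination_apply]
      simp only [smul_eq_mul]
      rfl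
  have hπT : Function.Surjective πT := Ideal.Quotient.mk_surjective
  have hπB : Function.Surjective πB := Ideal.Quotient.mk_surjective
  -- the comparison maps
  let h₂ : PT →ₗ[T] PB := (IsScalarTower.toAlgHom T PT PB).toLinearMap
  have hb₂ : IsBaseChange B h₂ := Algebra.IsPushout.out
  let h₁ : (Fin l → PT) →ₗ[T] (Fin l → PB) := h₂.compLeft (Fin l)
  have hb₁ : IsBaseChange B h₁ := IsBaseChange.finitePow (Fin l) hb₂
  have h₂_apply : ∀ p : PT, h₂ p = MvPolynomial.map (algebraMap T B) p := fun p => rfl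
  refine IsBaseChange.of_right_exact B h₁ h₂ (quotMap g J' hJ').toLinearMap (f := φT) (g := πT)
    (f' := φB) (g' := πB) ?_ ?_ hb₁ hb₂ hexT hπT hexB hπB
  · apply LinearMap.ext
    intro c
    change h₂ (Fintype.linearCombination PT g c) = Fintype.linearCombination PB gB (fun i => h₂ (c i))
    rw [Fintype.linearCombination_apply, Fintype.linearCombination_apply, h₂_apply, map_sum]
    refine Finset.sum_congr rfl fun i _ => ?_
    rw [h₂_apply, smul_eq_mul, smul_eq_mul, map_mul]
  · apply LinearMap.ext
    intro p
    rfl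

/-- The pushout square `T → B`, `T[x]/(g) → B[x]/(g)`, as `Algebra.IsPushout` for the algebra
structure given by `quotMap`. [cite: StacksProject, Tag 00R0 (4)] -/
theorem isPushout_quotMap :
    letI := (quotMap g J' hJ').toRingHom.toAlgebra
    Algebra.IsPushout T B (MvPolynomial (Fin k) T ⧸ Ideal.span (Set.range g))
      (MvPolynomial (Fin k) B ⧸ J') := by
  letI := (quotMap g J' hJ').toRingHom.toAlgebra
  haveI : IsScalarTower T (MvPolynomial (Fin k) T ⧸ Ideal.span (Set.range g))
      (MvPolynomial (Fin k) B ⧸ J') :=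
    IsScalarTower.of_algebraMap_eq fun t => ((quotMap g J' hJ').commutes t).symm
  refine ⟨?_⟩
  have : (IsScalarTower.toAlgHom T (MvPolynomial (Fin k) T ⧸ Ideal.span (Set.range g))
      (MvPolynomial (Fin k) B ⧸ J')).toLinearMap = (quotMap g J' hJ').toLinearMap := by
    apply LinearMap.ext
    intro x
    rfl
  rw [this]
  exact isBaseChange_quotMap g J' hJ'

end QuotBaseChange

/-- **The index type of the absolute Noetherian approximation**: finitely generated
`ℤ`-subalgebras of `A` containing every coefficient of the `fᵢ` (the `R_λ` of The Stacks
Project, Tag 00R0, chosen inside `R` so that the `f_{j,λ}` of the proof of Tag 00QV exist at every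
level). [cite: StacksProject, Tag 00R0 with the proof of Tag 00QV] -/
structure Idx : Type u where
  /-- the subalgebra -/
  T : Subalgebra ℤ A
  /-- it is finitely generated over `ℤ` -/
  fg : T.FG
  /-- it contains the coefficients of the `fᵢ` -/
  coeffs_subset : ∀ i, ((f i).coeffs : Set A) ⊆ T

namespace Idx

variable {f}

/-- Indices are ordered by inclusion of the subalgebras. [folklore] -/
instance : Preorder (Idx f) := Preorder.lift Idx.T

/-- `λ ≤ μ` is `λ.T ≤ μ.T`. [folklore] -/
theorem le_iff {lam mu : Idx f} : lam ≤ mu ↔ lam.T ≤ mu.T := Iff.rfl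

/-- The initial index: the subalgebra generated by the coefficients. [cite: StacksProject, Tag 00R0 with the proof of Tag 00QV] -/
noncomputable def init (f : Fin m → MvPolynomial (Fin n) A) : Idx f := by
  classical
  refine ⟨Algebra.adjoin ℤ ↑(Finset.univ.biUnion fun i => (f i).coeffs),
    Subalgebra.fg_adjoin_finset _, fun i a ha => ?_⟩
  exact Algebra.subset_adjoin (Finset.mem_biUnion.mpr ⟨i, Finset.mem_univ i, ha⟩)

/-- The family is nonempty. [folklore] -/
instance : Nonempty (Idx f) := ⟨init f⟩

/-- Enlarging an index by finitely many elements of `A`. [folklore] -/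
noncomputable def adjoin (lam : Idx f) (s : Finset A) : Idx f :=
  ⟨lam.T ⊔ Algebra.adjoin ℤ ↑s, lam.fg.sup (Subalgebra.fg_adjoin_finset s),
    fun i => (lam.coeffs_subset i).trans (SetLike.coe_subset_coe.mpr le_sup_left)⟩

/-- `λ ≤ λ.adjoin s`. [folklore] -/
theorem le_adjoin (lam : Idx f) (s : Finset A) : lam ≤ lam.adjoin s :=
  (le_sup_left : lam.T ≤ lam.T ⊔ _)

/-- `s ⊆ (λ.adjoin s).T`. [folklore] -/
theorem subset_adjoin (lam : Idx f) (s : Finset A) : (s : Set A) ⊆ (lam.adjoin s).T :=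
  Algebra.subset_adjoin.trans (SetLike.coe_subset_coe.mpr le_sup_right)

/-- The join of two indices. [folklore] -/
noncomputable def sup (lam mu : Idx f) : Idx f :=
  ⟨lam.T ⊔ mu.T, lam.fg.sup mu.fg,
    fun i => (lam.coeffs_subset i).trans (SetLike.coe_subset_coe.mpr le_sup_left)⟩

/-- The family is directed. [cite: StacksProject, Tag 00R0 with the proof of Tag 00QV] -/
instance : IsDirected (Idx f) (· ≤ ·) :=
  ⟨fun lam mu => ⟨lam.sup mu, (le_sup_left : lam.T ≤ lam.T ⊔ mu.T),
    (le_sup_right : mu.T ≤ lam.T ⊔ mu.T)⟩⟩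

/-- **Every element of `A` lies in some member of the family.** [folklore] -/
theorem exists_mem (lam : Idx f) (a : A) : ∃ mu : Idx f, lam ≤ mu ∧ a ∈ mu.T :=
  ⟨lam.adjoin {a}, lam.le_adjoin _, lam.subset_adjoin {a} (by simp)⟩

/-- Each `T` is a finite type `ℤ`-algebra. [folklore] -/
theorem finiteType (lam : Idx f) : Algebra.FiniteType ℤ lam.T :=
  (Subalgebra.fg_iff_finiteType _).mp lam.fg

/-- Each `T` is a Noetherian ring. [cite: StacksProject, Tag 00R0 with the proof of Tag 00QV] -/
theorem isNoetherianRing (lam : Idx f) : IsNoetherianRing lam.T :=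
  haveI := lam.finiteType
  Algebra.FiniteType.isNoetherianRing ℤ lam.T

/-! ### The restricted polynomials and the algebras `P_T` -/

/-- `T → A` is injective. [folklore] -/
theorem algebraMap_injective (lam : Idx f) : Function.Injective (algebraMap lam.T A) :=
  Subtype.val_injective

/-- The `fᵢ` come from `T[x]`. [folklore] -/
theorem exists_res (lam : Idx f) (i : Fin m) :
    ∃ p : MvPolynomial (Fin n) lam.T, MvPolynomial.map (algebraMap lam.T A) p = f i := by
  have : f i ∈ Set.range (MvPolynomial.map (algebraMap lam.T A)) := by
    rw [MvPolynomial.mem_range_map_iff_coeffs_subset, Subalgebra.setRange_algebraMap]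
    exact lam.coeffs_subset i
  exact this

/-- **The restricted polynomials `fᵢ,T ∈ T[x₁, …, x_n]`** (unique, the coefficient map being
injective). [cite: StacksProject, Tag 00R0 with the proof of Tag 00QV] -/
noncomputable def res (lam : Idx f) (i : Fin m) : MvPolynomial (Fin n) lam.T :=
  (lam.exists_res i).choose

/-- `fᵢ,T` maps to `fᵢ`. [cite: StacksProject, Tag 00R0 with the proof of Tag 00QV] -/
@[simp] theorem map_res (lam : Idx f) (i : Fin m) :
    MvPolynomial.map (algebraMap lam.T A) (lam.res i) = f i :=
  (lam.exists_res i).choose_spec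

/-- The ideal `(f_T) ⊆ T[x]`. [folklore] -/
noncomputable def J (lam : Idx f) : Ideal (MvPolynomial (Fin n) lam.T) :=
  Ideal.span (Set.range lam.res)

/-- **`P_T = T[x₁, …, x_n]/(f₁,T, …, f_m,T)`**. [cite: StacksProject, Tag 00R0 with the proof of Tag 00QV] -/
def P (lam : Idx f) : Type u := MvPolynomial (Fin n) lam.T ⧸ lam.J

/-- `P_T` is a commutative ring. [folklore] -/
instance (lam : Idx f) : CommRing lam.P := inferInstanceAs (CommRing (_ ⧸ lam.J))

/-- `P_T` is a `T`-algebra. [folklore] -/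
instance (lam : Idx f) : Algebra lam.T lam.P := inferInstanceAs (Algebra lam.T (_ ⧸ lam.J))

/-- `P_T` is Noetherian. [cite: StacksProject, Tag 00R0 with the proof of Tag 00QV] -/
instance isNoetherianRing_P (lam : Idx f) : IsNoetherianRing lam.P := by
  haveI := lam.isNoetherianRing
  haveI : IsNoetherianRing (MvPolynomial (Fin n) lam.T) := MvPolynomial.isNoetherianRing
  exact Ideal.Quotient.isNoetherianRing lam.J

/-- `P_T` is of finite type over `T`. [folklore] -/
instance finiteType_P (lam : Idx f) : Algebra.FiniteType lam.T lam.P :=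
  inferInstanceAs (Algebra.FiniteType lam.T (_ ⧸ lam.J))

variable (f) in
/-- **`A[x₁, …, x_n]/(f₁, …, f_m)`**, the colimit of the `P_T`. [cite: StacksProject, Tag 00R0 with the proof of Tag 00QV] -/
def _root_.Literature.RingTheory.Flat.Pinf : Type u :=
  MvPolynomial (Fin n) A ⧸ Ideal.span (Set.range f)

/-- `A[x]/(f)` is a commutative ring. [folklore] -/
instance : CommRing (Pinf f) := inferInstanceAs (CommRing (_ ⧸ Ideal.span (Set.range f)))

/-- `A[x]/(f)` is an `A`-algebra. [folklore] -/
instance : Algebra A (Pinf f) := inferInstanceAs (Algebra A (_ ⧸ Ideal.span (Set.range f)))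

/-- The quotient map `A[x] → A[x]/(f)`. [folklore] -/
noncomputable def _root_.Literature.RingTheory.Flat.Pinf.mk :
    MvPolynomial (Fin n) A →ₐ[A] Pinf f :=
  Ideal.Quotient.mkₐ A (Ideal.span (Set.range f))

/-- `A[x] → A[x]/(f)` is onto. [folklore] -/
theorem _root_.Literature.RingTheory.Flat.Pinf.mk_surjective :
    Function.Surjective (Pinf.mk (f := f)) :=
  Ideal.Quotient.mk_surjective

/-- The quotient map `T[x] → P_T`. [folklore] -/
noncomputable def mkP (lam : Idx f) : MvPolynomial (Fin n) lam.T →ₐ[lam.T] lam.P :=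
  Ideal.Quotient.mkₐ lam.T lam.J

/-- `T[x] → P_T` is onto. [folklore] -/
theorem mkP_surjective (lam : Idx f) : Function.Surjective lam.mkP :=
  Ideal.Quotient.mk_surjective

/-- `fᵢ,T` dies in `P_T`. [folklore] -/
theorem mkP_res (lam : Idx f) (i : Fin m) : lam.mkP (lam.res i) = 0 :=
  Ideal.Quotient.eq_zero_iff_mem.mpr (Ideal.subset_span ⟨i, rfl⟩)

/-- The polynomial map `T[x] → A[x]` as a `T`-algebra map. [folklore] -/
noncomputable def mapT (lam : Idx f) : MvPolynomial (Fin n) lam.T →ₐ[lam.T] MvPolynomial (Fin n) A :=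
  MvPolynomial.mapAlgHom (Algebra.ofId lam.T A)

/-- `mapT` is `MvPolynomial.map`. [folklore] -/
@[simp] theorem coe_mapT (lam : Idx f) (p : MvPolynomial (Fin n) lam.T) :
    lam.mapT p = MvPolynomial.map (algebraMap lam.T A) p := rfl

/-- `T[x] → A[x]` is injective. [folklore] -/
theorem mapT_injective (lam : Idx f) : Function.Injective lam.mapT :=
  MvPolynomial.map_injective _ lam.algebraMap_injective

-- `Pinf f` is a `T`-algebra through `T ⊆ A` (Mathlib's `Subalgebra.toAlgebra`), with
-- `IsScalarTower T A (Pinf f)`.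

/-- `(f) = (f_T)A[x]` as ideals of `A[x]`. [folklore] -/
theorem span_eq (lam : Idx f) :
    Ideal.span (Set.range f) =
      Ideal.span (Set.range fun i => MvPolynomial.map (algebraMap lam.T A) (lam.res i)) := by
  congr 1
  ext p
  simp only [Set.mem_range, map_res]

/-- **`P_T → A[x]/(f)`**. [cite: StacksProject, Tag 00R0 with the proof of Tag 00QV] -/
def toPinf (lam : Idx f) : lam.P →ₐ[lam.T] Pinf f :=
  quotMap lam.res (Ideal.span (Set.range f)) lam.span_eq

/-- `toPinf` on classes of polynomials. [folklore] -/
@[simp] theorem toPinf_mkP (lam : Idx f) (p : MvPolynomial (Fin n) lam.T) :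
    lam.toPinf (lam.mkP p) = Pinf.mk (MvPolynomial.map (algebraMap lam.T A) p) := rfl

/-- `A[x]/(f)` as a `P_T`-algebra through `toPinf`. [folklore] -/
instance algebra_P_Pinf (lam : Idx f) : Algebra lam.P (Pinf f) := lam.toPinf.toRingHom.toAlgebra

/-- `T → P_T → A[x]/(f)` is `T → A[x]/(f)`. [folklore] -/
instance isScalarTower_P_Pinf (lam : Idx f) : IsScalarTower lam.T lam.P (Pinf f) :=
  IsScalarTower.of_algebraMap_eq fun t => (lam.toPinf.commutes t).symm

/-- **`A[x]/(f) = A ⊗_T P_T`** (the colimit version of The Stacks Project, Tag 00R0 (4)).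
[cite: StacksProject, Tag 00R0 (4)] -/
instance isPushout_Pinf (lam : Idx f) : Algebra.IsPushout lam.T A lam.P (Pinf f) :=
  isPushout_quotMap lam.res (Ideal.span (Set.range f)) lam.span_eq

/-! ### Transition maps `P_T → P_{T′}` -/

section LE

variable {lam mu : Idx f}

/-- The algebra structure `T → T′` for `T ≤ T′` (not an instance). [folklore] -/
@[reducible] def algebraOfLE (h : lam ≤ mu) : Algebra lam.T mu.T :=
  (Subalgebra.inclusion h).toRingHom.toAlgebra

/-- `T → T′ → A` is `T → A` for the inclusion. [folklore] -/
theorem isScalarTower_of_le (h : lam ≤ mu) :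
    letI := algebraOfLE h
    IsScalarTower lam.T mu.T A :=
  letI := algebraOfLE h
  IsScalarTower.of_algebraMap_eq fun _ => rfl

variable [Algebra lam.T mu.T] [IsScalarTower lam.T mu.T A]

/-- A compatible algebra structure `T → T′` is the inclusion. [folklore] -/
theorem coe_algebraMap (t : lam.T) : (algebraMap lam.T mu.T t : A) = t :=
  (IsScalarTower.algebraMap_apply lam.T mu.T A t).symm

omit [IsScalarTower (↥lam.T) (↥mu.T) A] in
/-- `P_{T′}` as a `T`-algebra. (For `mu = lam` with the instance `Algebra.id`, this agrees
definitionally with the `T`-algebra structure of `P_T`; a user-supplied non-identity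
`Algebra T T` would create a diamond — only the structures `algebraOfLE` are intended.)
[folklore] -/
instance algebra_P_of_le : Algebra lam.T mu.P :=
  inferInstanceAs (Algebra lam.T (MvPolynomial (Fin n) mu.T ⧸ mu.J))

omit [IsScalarTower (↥lam.T) (↥mu.T) A] in
/-- `T → T′ → P_{T′}`. [folklore] -/
instance isScalarTower_P_of_le : IsScalarTower lam.T mu.T mu.P :=
  inferInstanceAs (IsScalarTower lam.T mu.T (MvPolynomial (Fin n) mu.T ⧸ mu.J))

/-- The restricted polynomials are compatible: `fᵢ,T ↦ fᵢ,T′`. [folklore] -/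
theorem map_algebraMap_res (i : Fin m) :
    MvPolynomial.map (algebraMap lam.T mu.T) (lam.res i) = mu.res i := by
  apply MvPolynomial.map_injective (algebraMap mu.T A) mu.algebraMap_injective
  rw [MvPolynomial.map_map, ← IsScalarTower.algebraMap_eq, map_res, map_res]

/-- `(f_{T′}) = (f_T)T′[x]`. [folklore] -/
theorem J_eq : mu.J = Ideal.span (Set.range fun i => MvPolynomial.map (algebraMap lam.T mu.T) (lam.res i)) := by
  change Ideal.span _ = _
  congr 1
  ext p
  simp only [Set.mem_range, map_algebraMap_res]

/-- **The transition map `P_T → P_{T′}`** for `T ≤ T′`. [cite: StacksProject, Tag 00R0 with the proof of Tag 00QV] -/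
def incl : lam.P →ₐ[lam.T] mu.P := quotMap lam.res mu.J J_eq

/-- `incl` on classes of polynomials. [folklore] -/
@[simp] theorem incl_mkP (p : MvPolynomial (Fin n) lam.T) :
    incl (lam.mkP p) = mu.mkP (MvPolynomial.map (algebraMap lam.T mu.T) p) := rfl

/-- `P_T → P_{T′} → A[x]/(f)` is `P_T → A[x]/(f)`. [folklore] -/
theorem toPinf_incl (y : lam.P) : mu.toPinf (incl y) = lam.toPinf y := by
  obtain ⟨p, rfl⟩ := lam.mkP_surjective y
  rw [incl_mkP, toPinf_mkP, toPinf_mkP, MvPolynomial.map_map, ← IsScalarTower.algebraMap_eq]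

/-- **`P_{T′} = T′ ⊗_T P_T`** for `T ≤ T′`, for the algebra structure given by `incl`.
[cite: StacksProject, Tag 00R0 (4)] -/
theorem isPushout_incl :
    letI := (incl : lam.P →ₐ[lam.T] mu.P).toRingHom.toAlgebra
    Algebra.IsPushout lam.T mu.T lam.P mu.P :=
  isPushout_quotMap lam.res mu.J J_eq

end LE

/-! ### Colimit properties -/

/-- **Every element of `A[x]/(f)` comes from some `P_{T′}`, `T′ ≥ T`.**
[cite: StacksProject, Tag 00R0 with the proof of Tag 00QV] -/
theorem exists_toPinf_eq (lam : Idx f) (x : Pinf f) :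
    ∃ mu : Idx f, lam ≤ mu ∧ ∃ y : mu.P, mu.toPinf y = x := by
  classical
  obtain ⟨p, rfl⟩ := Pinf.mk_surjective (f := f) x
  refine ⟨lam.adjoin p.coeffs, lam.le_adjoin _, ?_⟩
  have hp : p ∈ Set.range (MvPolynomial.map (algebraMap (lam.adjoin p.coeffs).T A)) := by
    rw [MvPolynomial.mem_range_map_iff_coeffs_subset, Subalgebra.setRange_algebraMap]
    exact lam.subset_adjoin p.coeffs
  obtain ⟨q, hq⟩ := hp
  exact ⟨(lam.adjoin p.coeffs).mkP q, by rw [toPinf_mkP, hq]⟩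

/-- **An element of `P_T` vanishing in `A[x]/(f)` vanishes in some `P_{T′}`, `T′ ≥ T`.**
[cite: StacksProject, Tag 00R0 with the proof of Tag 00QV] -/
theorem exists_incl_eq_zero (lam : Idx f) (y : lam.P) (hy : lam.toPinf y = 0) :
    ∃ (mu : Idx f) (h : lam ≤ mu),
      (letI := algebraOfLE h; haveI := isScalarTower_of_le h
       (incl : lam.P →ₐ[lam.T] mu.P) y) = 0 := by
  classical
  obtain ⟨p, rfl⟩ := lam.mkP_surjective y
  rw [toPinf_mkP] at hy
  have hmem : MvPolynomial.map (algebraMap lam.T A) p ∈ Ideal.span (Set.range f) :=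
    Ideal.Quotient.eq_zero_iff_mem.mp hy
  obtain ⟨c, hc⟩ := Ideal.mem_span_range_iff_exists_fun.mp hmem
  -- enlarge `T` by the coefficients of the `cᵢ`
  let s : Finset A := Finset.univ.biUnion fun i => (c i).coeffs
  let mu := lam.adjoin s
  have hle : lam ≤ mu := lam.le_adjoin s
  letI := algebraOfLE hle
  haveI := isScalarTower_of_le hle
  have hc' : ∀ i, c i ∈ Set.range (MvPolynomial.map (algebraMap mu.T A)) := fun i => by
    rw [MvPolynomial.mem_range_map_iff_coeffs_subset, Subalgebra.setRange_algebraMap]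
    exact subset_trans (fun a ha => Finset.mem_biUnion.mpr ⟨i, Finset.mem_univ i, ha⟩)
      (lam.subset_adjoin s)
  choose d hd using hc'
  refine ⟨mu, hle, ?_⟩
  rw [incl_mkP]
  apply Ideal.Quotient.eq_zero_iff_mem.mpr
  -- `p_{T′} = Σ dᵢ fᵢ,T′` since both sides agree in `A[x]`
  have key : MvPolynomial.map (algebraMap lam.T mu.T) p = ∑ i, d i * mu.res i := by
    apply MvPolynomial.map_injective (algebraMap mu.T A) mu.algebraMap_injective
    rw [MvPolynomial.map_map, ← IsScalarTower.algebraMap_eq, map_sum, ← hc]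
    refine Finset.sum_congr rfl fun i _ => ?_
    rw [map_mul, hd, map_res]
  rw [key]
  exact Submodule.sum_mem _ fun i _ => Ideal.mul_mem_left _ _ (Ideal.subset_span ⟨i, rfl⟩)

end Idx

end Literature.RingTheory.Flat

end
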